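/-
Copyright: literature formalisation for the harness. Statements follow the cited text.
-/
import Literature.AlgebraicGeometry.CossartPiltant200819.StableModelCriterion2008
import Literature.AlgebraicGeometry.Resolution.NormalBirationalQuasiFinite
import Literature.AlgebraicGeometry.Resolution.RegularLocalRingsNormal
import HarnessLib

/-!
# Cossart–Piltant 2008, Lemma 9.4 (journal 9.2), case `e = l`: the conjugate-stability criterion
PROVED (Zariski's Main Theorem)

V. Cossart, O. Piltant, *Resolution of singularities of threefolds in positive characteristic I*,
J. Algebra 320 (2008) 1051–1082 [CossartPiltant2008]; manuscript hal-00139124 ("HAL"). Sequel of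
`StableModelCriterion2008.lean`, which isolates, inside the printed proof of Lemma 9.4 (HAL p. 30,
l. 14–16: "`S` is stable by `G`, since any conjugate of `S` is dominated by `W`, hence equal to
`S`"), the criterion `ConjugateStability`: for `σ ∈ Aut(L/K)` with `σW = W`, `κ(W)/k` algebraic,
and `S` a local uniformization of `W/k` whose contracted centre `(m_S ∩ K)S` is `m_S`-primary,
`σS = S`. In [Fu1997] (Introduction, p. 614) this is the sentence "`Q` is `N`-primary, and hence
`S` lies over `R`, i.e., `S` is a localization of the integral closure of `R` in `L` at a maximal
ideal [A4, Proposition 1]" (A4 = [Abhyankar1957]), from which the cell infers (Fu prints no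
such sentence): an automorphism of `L/K` fixing `W` permutes the local rings of `R̄` and fixes the
one dominated by `W`; cf. the Galois remark after Problem 9.2 at HAL p. 27, l. 33–35 ("problem
9.2 has trivially an affirmative answer when `L/K` is Galois with group `G` (in which case the
invariant ring `R := S^G` lies below `S`)"), which concerns `S^G` lying below `S`. In
`StableModelCriterion2008.lean` the criterion entered as a HYPOTHESIS
(`gStableUniformizationAbove_of_primary`,
`tamePrimeDescentHighRank_of_leaves`). This file PROVES it (`conjugateStability_holds`), in the
typed generality (any fields `k ⊆ K ⊆ L`, any `σ`), by the argument through Zariski's Main Theorem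
written out in item 3 of the module docstring of `StableModelCriterion2008.lean`, using the tree's
local form of ZMT for normal local domains
(`Resolution.bijective_algebraMap_of_essFiniteType_of_forall_isPrime`, file
`Resolution/NormalBirationalQuasiFinite.lean`: a local, essentially of finite type, birational
extension `N ⊆ S' ⊆ Frac N` of a normal local domain `N` with `m_N S'` having `m_{S'}` as its only
prime and `κ(S')/κ(N)` algebraic is trivial) and
`Resolution.isIntegrallyClosed_of_isRegularLocalRing` (regular local rings are normal).

## The proof (kernel-checked below)

Let `S = A_𝔭` (`A ⊆ W` an affine model with `Frac A = L`, `𝔭 = m_W ∩ A`) be regular, `σW = W`,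
`κ(W)/k` algebraic, `(m_S ∩ K)S` primary for `m_S`. Put `B := A·σA = A ⊔ σA` (finitely generated,
`B ⊆ W` as `σW = W`) and `E := B_{m_W ∩ B}`, the local ring of `W` on `B` (`locModel`). Then
`S ⊆ E`, `σS ⊆ E` (`W(σt) = 0 ⟺ W(t) = 0`), `E ⊆ W`, `m_E = m_W ∩ E`, `E` is essentially of finite
type over `k`, hence over `S`, `S → E` is local (both are dominated by `W`) and birational
(`Frac S = L ⊇ E`). (i) `κ(E)/κ(S)` is algebraic: every `x ∈ E ⊆ W` has `W(f(x)) > 0` for some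
`0 ≠ f ∈ k[X]` (`κ(W)/k` algebraic), and a non-zero coefficient of `f` is a unit of `S`.
(ii) `m_E ⊆ √(m_S E)`: the elements of `E` algebraic over `k` modulo `J := √(m_S E)` form a
`k`-subalgebra `T` (preimage of the integral closure of `k` in `E/J`). `A ⊆ T`: `f(a) ∈ 𝔭 ⊆ m_S`
for the `f` of (i). `σA ⊆ T`: `f(σa) = σ(f(a))` with `y := f(a) ∈ m_S`; by primarity
`yⁿ = Σ cᵢ gᵢ` with `cᵢ ∈ S`, `gᵢ ∈ m_S ∩ K`, so `σ(y)ⁿ = Σ σ(cᵢ) gᵢ ∈ m_S E` (`σ` fixes `K`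
pointwise, `σ(cᵢ) ∈ σS ⊆ E`), i.e. `σ(y) ∈ J`. Hence `B ⊆ T`. For `b ∈ B` with `W(b) > 0` take
`f` monic with `f(b) ∈ J`, `f = X^m g`, `g(0) ≠ 0`: `g(b) = g(0) + b·h(b)` is a unit of `E`, so
`b^m ∈ J` and `b ∈ J`. Every element of `m_E` is `b/t` with such a `b` and `t⁻¹ ∈ E`, so lies in
`J`; a prime of `E` containing `m_S E` contains `J ⊇ m_E`. By ZMT, `S = E ⊇ σS`. Applying this
to `σ⁻¹` (`σ⁻¹W = W`) gives `σ⁻¹S ⊆ S`, whence `σS = S`.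

No hypothesis on dimension, characteristic, rank or rational rank of `W`, or on `k`, is used; of
`IsLocalUniformizationOf` only "local model + normal" is used (regularity enters through
normality). PROVED here, besides the criterion: the corollaries of
`gStableUniformizationAbove_of_primary` ((S3\*) for `k = k̄`, rational rank `≥ 2`) and
`tamePrimeDescentHighRank_of_leaves` (Lemma 9.4 for `k = k̄`, rational rank `≥ 2`) with the
`ConjugateStability` binder discharged; their remaining non-printed binder `NormalModelAboveLe`
is `NormalModelAbove2008.normalModelAboveLe_holds` (not imported here). NOTHING here asserts or
refutes a statement of [CossartPiltant2008]: Lemma 9.4 (= journal Lemma 9.2) remains the cited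
named fact `TamePrimeDescent`. Cell record: pub-hironaka GAPS §GA, rows G7-A21.S, G9-A21.S-R.

## Sources
- [CossartPiltant2008] HAL hal-00139124v1: Lemma 9.4 and its proof (p. 29–30, l. 3–16), the
  remark p. 27 l. 33–35 after Problem 9.2, §3 "Local rings and models", "lies over" (p. 4).
- [Fu1997] D. Fu, Local weak simultaneous resolution for high rational ranks, J. Algebra 194
  (1997) 614–630: Introduction p. 614 ("`Q` is `N`-primary, and hence `S` lies over `R` …
  [A4, Proposition 1]").
- Zariski's Main Theorem in Grothendieck's algebraic form: [StacksProject] Tag 00Q9, over a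
  normal local base Tag 0AB1 (Mathlib `Algebra.ZariskisMainProperty.of_finiteType`; tree
  `Resolution/NormalBirationalQuasiFinite.lean`,
  `bijective_algebraMap_of_essFiniteType_of_forall_isPrime`).
  Regular local ⇒ integrally closed: [Matsumura1987, Thm. 19.4] (tree
  `Resolution/RegularLocalRingsNormal.lean`, `isIntegrallyClosed_of_isRegularLocalRing`).
-/

noncomputable section

namespace Literature.AlgebraicGeometry.CossartPiltant200819.CP2008

open Literature.AlgebraicGeometry.Resolution IsLocalRing Polynomial
open scoped Pointwise

universe u

/-! ### Values `0` in a valuation ring, and automorphisms fixing it -/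

section Valuation

variable {L : Type u} [Field L] (W : ValuationSubring L)

/-- `W(b/t) = W(b)` for `W(t) = 0` (multiplicatively: value `1`). [folklore] -/
theorem valuation_mul_inv_eq {b t : L} (hvt : W.valuation t = 1) :
    W.valuation (b * t⁻¹) = W.valuation b := by
  rw [map_mul, map_inv₀, hvt, inv_one, mul_one]

variable {K : Type u} [Field K] [Algebra K L] {σ : L ≃ₐ[K] L}

/-- `σW = W ⇒ (W(σx) = 0 ⟺ W(x) = 0)` (no finiteness of `L/K` needed; cf.
`valuation_map_eq` of `PStepTrichotomy2008.lean` for `[L : K] < ∞`). [folklore] -/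
theorem valuation_map_eq_one_iff (hσ : σ • W = W) (x : L) :
    W.valuation (σ x) = 1 ↔ W.valuation x = 1 := by
  have key : ∀ τ : L ≃ₐ[K] L, τ • W = W → ∀ y : L, W.valuation y = 1 →
      W.valuation (τ y) = 1 := by
    intro τ hτ y hy
    have hy0 : y ≠ 0 := by
      rintro rfl
      rw [map_zero] at hy
      exact zero_ne_one hy
    have hyW : y ∈ W := (W.valuation_le_one_iff y).mp hy.le
    have hyi : y⁻¹ ∈ W := (W.valuation_le_one_iff _).mp (by rw [map_inv₀, hy, inv_one])
    exact valuation_eq_one_of_mem_of_inv_mem W (EmbeddingLike.map_ne_zero_iff.mpr hy0)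
      (map_mem_of_smul_eq W τ hτ hyW) (by rw [← map_inv₀]; exact map_mem_of_smul_eq W τ hτ hyi)
  refine ⟨fun h => ?_, key σ hσ x⟩
  have h' := key σ⁻¹ (inv_smul_eq_iff.mpr hσ.symm) (σ x) h
  rwa [AlgEquiv.aut_inv, AlgEquiv.symm_apply_apply] at h'

end Valuation

/-! ### The local ring of `W` on a `k`-subalgebra `B ⊆ W` -/

section LocModel

variable {k L : Type u} [Field k] [Field L] [Algebra k L] (W : ValuationSubring L)

/-- The valuation ring `W ⊇ k` as a `k`-subalgebra of `L`. [folklore] -/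
def valuationSubalgebra (hk : ∀ c : k, algebraMap k L c ∈ W) : Subalgebra k L :=
  { W.toSubring with algebraMap_mem' := hk }

/-- Membership in `valuationSubalgebra`. [folklore] -/
@[simp] theorem mem_valuationSubalgebra (hk : ∀ c : k, algebraMap k L c ∈ W) (x : L) :
    x ∈ valuationSubalgebra W hk ↔ x ∈ W := Iff.rfl

/-- **The local ring of `W` on `B`**, `B_{m_W ∩ B} ⊆ L`, for a `k`-subalgebra `B` of `L`
(Cossart–Piltant 2008, §3, HAL p. 4, "Local rings and models": the local model `R = A_𝔭` of `V`
on an affine model `A ⊆ V`; the set displayed in `IsLocalModelOf`): the fractions `b/t` with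
`b, t ∈ B` and `W(t) = 0`.
[cite: CossartPiltant2008, Section 3 (HAL p. 4, "Local rings and models")] -/
def locModel (B : Subalgebra k L) : Subalgebra k L where
  carrier := {x | ∃ b ∈ B, ∃ t ∈ B, W.valuation t = 1 ∧ x = b * t⁻¹}
  mul_mem' := by
    rintro x y ⟨b, hb, t, ht, hvt, rfl⟩ ⟨b', hb', t', ht', hvt', rfl⟩
    exact ⟨b * b', B.mul_mem hb hb', t * t', B.mul_mem ht ht',
      by rw [map_mul, hvt, hvt', mul_one], by rw [mul_inv]; ring⟩
  one_mem' := ⟨1, B.one_mem, 1, B.one_mem, by simp, by simp⟩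
  add_mem' := by
    rintro x y ⟨b, hb, t, ht, hvt, rfl⟩ ⟨b', hb', t', ht', hvt', rfl⟩
    have ht0 : t ≠ 0 := by
      rintro rfl
      rw [map_zero] at hvt
      exact zero_ne_one hvt
    have ht0' : t' ≠ 0 := by
      rintro rfl
      rw [map_zero] at hvt'
      exact zero_ne_one hvt'
    exact ⟨b * t' + b' * t, B.add_mem (B.mul_mem hb ht') (B.mul_mem hb' ht), t * t',
      B.mul_mem ht ht', by rw [map_mul, hvt, hvt', mul_one], by field_simp⟩
  zero_mem' := ⟨0, B.zero_mem, 1, B.one_mem, by simp, by simp⟩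
  algebraMap_mem' c := ⟨algebraMap k L c, B.algebraMap_mem c, 1, B.one_mem, by simp, by simp⟩

variable (B : Subalgebra k L)

/-- The underlying set of `locModel W B` is the set displayed in `IsLocalModelOf`. [folklore] -/
theorem coe_locModel :
    (locModel W B : Set L) = {x | ∃ b ∈ B, ∃ t ∈ B, W.valuation t = 1 ∧ x = b * t⁻¹} := rfl

/-- Membership in `locModel W B`. [folklore] -/
theorem mem_locModel_iff {x : L} :
    x ∈ locModel W B ↔ ∃ b ∈ B, ∃ t ∈ B, W.valuation t = 1 ∧ x = b * t⁻¹ := Iff.rfl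

/-- `B ⊆ B_{m_W ∩ B}`. [folklore] -/
theorem le_locModel : B ≤ locModel W B := fun b hb =>
  ⟨b, hb, 1, B.one_mem, by simp, by simp⟩

/-- `B ⊆ B' ⇒ B_{m_W ∩ B} ⊆ B'_{m_W ∩ B'}`. [folklore] -/
theorem locModel_mono {B B' : Subalgebra k L} (h : B ≤ B') : locModel W B ≤ locModel W B' := by
  rintro x ⟨b, hb, t, ht, hvt, rfl⟩
  exact ⟨b, h hb, t, h ht, hvt, rfl⟩

/-- `B ⊆ W ⇒ B_{m_W ∩ B} ⊆ W` (`W` dominates its local ring on `B`). [folklore] -/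
theorem locModel_le_of_le (hBW : ∀ x ∈ B, x ∈ W) : ∀ x ∈ locModel W B, x ∈ W := by
  rintro x ⟨b, hb, t, ht, hvt, rfl⟩
  exact (W.valuation_le_one_iff _).mp
    ((valuation_mul_inv_eq W hvt).le.trans ((W.valuation_le_one_iff b).mpr (hBW b hb)))

/-- Elements of value `0` are invertible in `B_{m_W ∩ B}`. [folklore] -/
theorem inv_mem_locModel {x : L} (hx : x ∈ locModel W B) (h1 : W.valuation x = 1) :
    x⁻¹ ∈ locModel W B := by
  obtain ⟨b, hb, t, ht, hvt, rfl⟩ := hx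
  rw [valuation_mul_inv_eq W hvt] at h1
  exact ⟨t, ht, b, hb, h1, by rw [mul_inv, inv_inv, mul_comm]⟩

/-- For `B ⊆ W`, the units of `B_{m_W ∩ B}` are its elements of value `0`. [folklore] -/
theorem isUnit_iff_valuation_eq_one (hBW : ∀ x ∈ B, x ∈ W) (x : locModel W B) :
    IsUnit x ↔ W.valuation (x : L) = 1 := by
  constructor
  · rintro ⟨u, rfl⟩
    have h : ((u : locModel W B) : L) * ((u⁻¹ : (locModel W B)ˣ) : locModel W B) = 1 := by
      rw [← Subalgebra.coe_mul, u.mul_inv, Subalgebra.coe_one]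
    exact valuation_eq_one_of_mul_eq_one W (locModel_le_of_le W B hBW _ (u : locModel W B).2)
      (locModel_le_of_le W B hBW _ ((u⁻¹ : (locModel W B)ˣ) : locModel W B).2) h
  · intro h1
    have hx0 : (x : L) ≠ 0 := by
      intro h0
      rw [h0, map_zero] at h1
      exact zero_ne_one h1
    exact ⟨⟨x, ⟨(x : L)⁻¹, inv_mem_locModel W B x.2 h1⟩, Subtype.ext (mul_inv_cancel₀ hx0),
      Subtype.ext (inv_mul_cancel₀ hx0)⟩, rfl⟩

/-- For `B ⊆ W`, `B_{m_W ∩ B}` is a local ring. [folklore] -/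
theorem isLocalRing_locModel (hBW : ∀ x ∈ B, x ∈ W) : IsLocalRing (locModel W B) := by
  refine IsLocalRing.of_isUnit_or_isUnit_one_sub_self fun x => ?_
  by_cases h1 : W.valuation (x : L) = 1
  · exact Or.inl ((isUnit_iff_valuation_eq_one W B hBW x).mpr h1)
  · refine Or.inr ((isUnit_iff_valuation_eq_one W B hBW _).mpr ?_)
    have hlt : W.valuation (x : L) < 1 :=
      lt_of_le_of_ne ((W.valuation_le_one_iff _).mpr (locModel_le_of_le W B hBW _ x.2)) h1
    simpa using W.valuation.map_one_sub_of_lt hlt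

/-- For `B ⊆ W`, the maximal ideal of `B_{m_W ∩ B}` is its centre `m_W ∩ B_{m_W ∩ B}`.
[folklore] -/
theorem mem_maximalIdeal_locModel_iff (hBW : ∀ x ∈ B, x ∈ W) [IsLocalRing (locModel W B)]
    (x : locModel W B) : x ∈ maximalIdeal (locModel W B) ↔ W.valuation (x : L) < 1 := by
  rw [IsLocalRing.mem_maximalIdeal, mem_nonunits_iff, isUnit_iff_valuation_eq_one W B hBW]
  have hle : W.valuation (x : L) ≤ 1 :=
    (W.valuation_le_one_iff _).mpr (locModel_le_of_le W B hBW _ x.2)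
  exact ⟨fun h => lt_of_le_of_ne hle h, fun h => h.ne⟩

/-- `Frac(B_{m_W ∩ B}) = L` as soon as `B_{m_W ∩ B}` contains a subalgebra with fraction field
`L`. [folklore] -/
theorem isFractionRing_locModel_of_le {A : Subalgebra k L} [IsFractionRing A L]
    (hA : A ≤ locModel W B) : IsFractionRing (locModel W B) L :=
  IsFractionRing.of_field (locModel W B) L fun z => by
    obtain ⟨a, b, -, rfl⟩ := IsFractionRing.div_surjective (A := A) z
    exact ⟨⟨a, hA a.2⟩, ⟨b, hA b.2⟩, rfl⟩

/-- `B_{m_W ∩ B}` is essentially of finite type over `k` when `B` is finitely generated: it is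
the localisation of `B` at the elements of value `0`. [folklore] -/
theorem essFiniteType_locModel {B : Subalgebra k L} (hfg : B.FG) :
    Algebra.EssFiniteType k (locModel W B) := by
  classical
  obtain ⟨t, ht⟩ := hfg
  rw [Algebra.essFiniteType_iff]
  have htE : ∀ g ∈ t, g ∈ locModel W B := fun g hg =>
    le_locModel W B (ht ▸ Algebra.subset_adjoin hg)
  refine ⟨t.subtype (· ∈ locModel W B), fun x => ?_⟩
  have hadj : ∀ y : locModel W B, (y : L) ∈ B →
      y ∈ Algebra.adjoin k ((t.subtype (· ∈ locModel W B) : Finset (locModel W B)) :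
        Set (locModel W B)) := by
    intro y hy
    have hmap : (Algebra.adjoin k ((t.subtype (· ∈ locModel W B) :
        Finset (locModel W B)) : Set (locModel W B))).map (locModel W B).val =
        Algebra.adjoin k (t : Set L) := by
      rw [AlgHom.map_adjoin]
      congr 1
      ext g
      simp only [Set.mem_image, Finset.mem_coe, Finset.mem_subtype, Subalgebra.coe_val]
      constructor
      · rintro ⟨y, hy, rfl⟩
        exact hy
      · intro hg
        exact ⟨⟨g, htE g hg⟩, hg, rfl⟩
    have hy' : (y : L) ∈ (Algebra.adjoin k ((t.subtype (· ∈ locModel W B) :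
        Finset (locModel W B)) : Set (locModel W B))).map (locModel W B).val := by
      rw [hmap, ht]
      exact hy
    obtain ⟨z, hz, hzy⟩ := Subalgebra.mem_map.mp hy'
    have hzy' : z = y := Subtype.ext hzy
    rwa [hzy'] at hz
  obtain ⟨b, hb, s, hs, hvs, hx⟩ := (mem_locModel_iff W B).mp x.2
  have hs0 : s ≠ 0 := by
    rintro rfl
    rw [map_zero] at hvs
    exact zero_ne_one hvs
  have hsE : s ∈ locModel W B := le_locModel W B hs
  have hsiE : s⁻¹ ∈ locModel W B := inv_mem_locModel W B hsE hvs
  refine ⟨⟨s, hsE⟩, hadj _ hs, ⟨⟨⟨s, hsE⟩, ⟨s⁻¹, hsiE⟩, Subtype.ext (mul_inv_cancel₀ hs0),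
    Subtype.ext (inv_mul_cancel₀ hs0)⟩, rfl⟩, hadj _ ?_⟩
  show (x : L) * s ∈ B
  rw [hx, inv_mul_cancel_right₀ hs0]
  exact hb

end LocModel

/-! ### The criterion -/

section Main

variable {k K L : Type u} [Field k] [Field K] [Field L] [Algebra k K] [Algebra K L] [Algebra k L]
  [IsScalarTower k K L] (W : ValuationSubring L) (hk : ∀ c : k, algebraMap k L c ∈ W)

/-- **Residual algebraicity, elementwise**: if `κ(W)/k` is algebraic then every `x ∈ W`
satisfies `W(f(x)) > 0` for some non-zero `f ∈ k[X]` (lift a non-zero polynomial killing the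
residue of `x`). [folklore] -/
theorem exists_aeval_valuation_lt_one (hres : residueTrdeg k W hk = 0) {x : L} (hx : x ∈ W) :
    ∃ f : k[X], f ≠ 0 ∧ W.valuation (aeval x f) < 1 := by
  letI := algebraOfMem k W hk
  haveI := isScalarTower_algebraOfMem k W hk
  haveI : Algebra.IsAlgebraic k (ResidueField W) := (residueTrdeg_eq_zero_iff W hk).mp hres
  obtain ⟨f, hf0, hf⟩ := Algebra.IsAlgebraic.isAlgebraic (R := k) (residue W ⟨x, hx⟩)
  refine ⟨f, hf0, ?_⟩
  have h1 : aeval (residue W ⟨x, hx⟩) f = residue W (aeval (⟨x, hx⟩ : W) f) := by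
    rw [← ResidueField.algebraMap_eq, aeval_algebraMap_apply]
  rw [h1, residue_eq_zero_iff, ValuationSubring.valuation_lt_one_iff] at hf
  have h2 : ((aeval (⟨x, hx⟩ : W) f : W) : L) = aeval x f :=
    (aeval_algebraMap_apply L (⟨x, hx⟩ : W) f).symm
  rwa [h2] at hf

include hk in
/-- For `x ∈ W ⊇ k` with `W(x) > 0` and `g ∈ k[X]` with `g(0) ≠ 0`, `g(x) = g(0) + x·h(x)` has
value `0`. [folklore] -/
theorem valuation_aeval_eq_one_of_coeff_ne_zero {x : L} (hxW : x ∈ W)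
    (hx : W.valuation x < 1) {g : k[X]} (hg : g.coeff 0 ≠ 0) :
    W.valuation (aeval x g) = 1 := by
  have hsplit : aeval x g = x * aeval x g.divX + algebraMap k L (g.coeff 0) := by
    conv_lhs => rw [← X_mul_divX_add g]
    rw [map_add, map_mul, aeval_X, aeval_C]
  have hq : aeval x g.divX ∈ W := by
    have h := (aeval_algebraMap_apply L (⟨x, hxW⟩ : valuationSubalgebra W hk) g.divX).symm
    change ((aeval (⟨x, hxW⟩ : valuationSubalgebra W hk) g.divX :
      valuationSubalgebra W hk) : L) = aeval x g.divX at h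
    rw [← h]
    exact (aeval (⟨x, hxW⟩ : valuationSubalgebra W hk) g.divX).2
  have hc : W.valuation (algebraMap k L (g.coeff 0)) = 1 :=
    valuation_eq_one_of_mem_of_inv_mem W ((_root_.map_ne_zero _).mpr hg) (hk _)
      (by rw [← map_inv₀]; exact hk _)
  have hlt : W.valuation (x * aeval x g.divX) < W.valuation (algebraMap k L (g.coeff 0)) := by
    rw [hc, map_mul]
    calc W.valuation x * W.valuation (aeval x g.divX)
        ≤ W.valuation x * 1 := by
          gcongr
          exact (W.valuation_le_one_iff _).mpr hq
      _ = W.valuation x := mul_one _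
      _ < 1 := hx
  rw [hsplit, Valuation.map_add_eq_of_lt_right _ hlt, hc]

/-- **The key inclusion `σS ⊆ S`** ([Fu1997] p. 614 / HAL p. 30 l. 14–16, via Zariski's Main
Theorem; see the module docstring): for `σ ∈ Aut(L/K)` with `σW = W`, `κ(W)/k` algebraic, and
`S` a local uniformization of `W/k` with `(m_S ∩ K)S` primary for `m_S`, every conjugate `σs`,
`s ∈ S`, lies in `S` — indeed the local ring `E` of `W` on `A·σA` equals `S`.
[cite: Fu1997, Introduction (p. 614); CossartPiltant2008, Lemma 9.4 proof (HAL p. 30, l. 14-16)] -/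
theorem image_subset_of_smul_eq (hres : residueTrdeg k W hk = 0) (σ : L ≃ₐ[K] L)
    (hσ : σ • W = W) {S : Subalgebra k L} (hS : IsLocalUniformizationOf k L W S)
    (hprim : ContractedCentrePrimary K W S) : σ '' (S : Set L) ⊆ S := by
  classical
  obtain ⟨⟨A, hAfg, hAfrac, hAW, hSset⟩, hreg⟩ := hS
  have hSeq : S = locModel W A := SetLike.coe_injective (hSset.trans (coe_locModel W A).symm)
  subst hSeq
  haveI := hreg
  haveI := hAfrac
  have hAW' : ∀ x ∈ A, x ∈ W := fun x hx => hAW hx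
  -- the conjugate affine model `σA`, `B := A·σA` and the local ring `E` of `W` on `B`
  let τ : L →ₐ[k] L := ((σ.restrictScalars k : L ≃ₐ[k] L) : L →ₐ[k] L)
  have hτ : ∀ x, τ x = σ x := fun _ => rfl
  let B : Subalgebra k L := A ⊔ A.map τ
  have hAB : A ≤ B := le_sup_left
  have hσB : ∀ a ∈ A, σ a ∈ B := fun a ha =>
    (le_sup_right : A.map τ ≤ B) (Subalgebra.mem_map.mpr ⟨a, ha, rfl⟩)
  have hBW : ∀ x ∈ B, x ∈ W := by
    have h : B ≤ valuationSubalgebra W hk := sup_le (fun x hx => hAW' x hx) (by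
      intro x hx
      obtain ⟨a, ha, rfl⟩ := Subalgebra.mem_map.mp hx
      exact map_mem_of_smul_eq W σ hσ (hAW' a ha))
    exact fun x hx => h hx
  have hBfg : B.FG := hAfg.sup (hAfg.map τ)
  let E : Subalgebra k L := locModel W B
  have hSE : locModel W A ≤ E := locModel_mono W hAB
  have hEW : ∀ x ∈ E, x ∈ W := locModel_le_of_le W B hBW
  have hσSE : ∀ s : locModel W A, σ s ∈ E := by
    rintro ⟨x, hx⟩
    obtain ⟨a, ha, t, ht, hvt, rfl⟩ := (mem_locModel_iff W A).mp hx
    refine ⟨σ a, hσB a ha, σ t, hσB t ht, (valuation_map_eq_one_iff W hσ t).mpr hvt, ?_⟩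
    rw [map_mul, map_inv₀]
  -- instances: `S → E` local, essentially of finite type, birational; `S` a normal local domain
  haveI : IsLocalRing E := isLocalRing_locModel W B hBW
  haveI : IsFractionRing (locModel W A) L :=
    isFractionRing_locModel_of_le W A (le_locModel W A)
  haveI : IsIntegrallyClosed (locModel W A) := isIntegrallyClosed_of_isRegularLocalRing _
  let ι : locModel W A →ₐ[k] E := Subalgebra.inclusion hSE
  letI : Algebra (locModel W A) E := ι.toRingHom.toAlgebra
  have hι : ∀ s : locModel W A, algebraMap (locModel W A) E s = ι s := fun _ => rfl
  haveI : IsScalarTower (locModel W A) E L := IsScalarTower.of_algebraMap_eq fun _ => rfl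
  haveI : IsScalarTower k (locModel W A) E := IsScalarTower.of_algebraMap_eq fun _ => rfl
  haveI : Algebra.EssFiniteType k E := essFiniteType_locModel W hBfg
  haveI : Algebra.EssFiniteType (locModel W A) E := Algebra.EssFiniteType.of_comp k _ E
  haveI : IsLocalHom (algebraMap (locModel W A) E) := ⟨fun s hs =>
    (isUnit_iff_valuation_eq_one W A hAW' s).mpr
      ((isUnit_iff_valuation_eq_one W B hBW (ι s)).mp hs)⟩
  have hmS : ∀ s : locModel W A, s ∈ maximalIdeal (locModel W A) ↔ W.valuation (s : L) < 1 :=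
    mem_maximalIdeal_locModel_iff W A hAW'
  have hmE : ∀ e : E, e ∈ maximalIdeal E ↔ W.valuation (e : L) < 1 :=
    mem_maximalIdeal_locModel_iff W B hBW
  -- `σ` restricted to `S`, with values in `E`
  let ψ : locModel W A →ₐ[k] E := (τ.comp (locModel W A).val).codRestrict E fun s => hσSE s
  have hψ : ∀ s : locModel W A, ((ψ s : E) : L) = σ s := fun _ => rfl
  -- `I := m_S E`, `J := √I`, `T :=` the elements of `E` algebraic over `k` modulo `J`
  let I : Ideal E := (maximalIdeal (locModel W A)).map (algebraMap (locModel W A) E)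
  let J : Ideal E := I.radical
  have hIJ : I ≤ J := Ideal.le_radical
  let T : Subalgebra k E := (integralClosure k (E ⧸ J)).comap (Ideal.Quotient.mkₐ k J)
  have hT_of : ∀ (e : E) (f : k[X]), f ≠ 0 → aeval e f ∈ J → e ∈ T := by
    intro e f hf0 hfe
    rw [Subalgebra.mem_comap, mem_integralClosure_iff]
    refine IsAlgebraic.isIntegral ⟨f, hf0, ?_⟩
    change aeval (algebraMap E (E ⧸ J) e) f = 0
    rw [aeval_algebraMap_apply, Ideal.Quotient.algebraMap_eq, Ideal.Quotient.eq_zero_iff_mem]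
    exact hfe
  have hJ_of_T : ∀ e : E, e ∈ T → W.valuation (e : L) < 1 → e ∈ J := by
    intro e heT hve
    rw [Subalgebra.mem_comap, mem_integralClosure_iff] at heT
    obtain ⟨f, hfm, hf⟩ := heT
    have hfJ : aeval e f ∈ J := by
      rw [← aeval_def] at hf
      change aeval (algebraMap E (E ⧸ J) e) f = 0 at hf
      rwa [aeval_algebraMap_apply, Ideal.Quotient.algebraMap_eq,
        Ideal.Quotient.eq_zero_iff_mem] at hf
    obtain ⟨g, hfg, hg⟩ := f.exists_eq_pow_rootMultiplicity_mul_and_not_dvd hfm.ne_zero 0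
    rw [C_0, sub_zero] at hfg hg
    have hg0 : g.coeff 0 ≠ 0 := fun h => hg (X_dvd_iff.mpr h)
    have hunit : IsUnit (aeval e g) := by
      refine (isUnit_iff_valuation_eq_one W B hBW _).mpr ?_
      rw [aeval_subalgebra_coe]
      exact valuation_aeval_eq_one_of_coeff_ne_zero W hk (hEW _ e.2) hve hg0
    rw [hfg, map_mul, map_pow, aeval_X, Ideal.mul_unit_mem_iff_mem _ hunit] at hfJ
    exact Ideal.mem_radical_of_pow_mem hfJ
  -- (R1) `A ⊆ T`
  have hAT : ∀ a (ha : a ∈ A), (⟨a, hSE (le_locModel W A ha)⟩ : E) ∈ T := by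
    intro a ha
    obtain ⟨f, hf0, hfa⟩ := exists_aeval_valuation_lt_one W hk hres (hAW' a ha)
    refine hT_of _ f hf0 (hIJ ?_)
    have h1 : aeval (⟨a, hSE (le_locModel W A ha)⟩ : E) f =
        algebraMap (locModel W A) E (aeval (⟨a, le_locModel W A ha⟩ : locModel W A) f) := by
      rw [← aeval_algebraMap_apply]
      rfl
    rw [h1]
    refine Ideal.mem_map_of_mem _ ((hmS _).mpr ?_)
    rw [aeval_subalgebra_coe]
    exact hfa
  -- (R2) `σA ⊆ T`: transport of the primary contraction along `ψ`
  have hψI : (Ideal.span {z : locModel W A | (z : L) ∈ Set.range (algebraMap K L) ∧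
      W.valuation (z : L) < 1}).map ψ ≤ I := by
    rw [Ideal.map_span, Ideal.span_le]
    rintro _ ⟨z, ⟨⟨c, hc⟩, hvz⟩, rfl⟩
    have h3 : ψ z = algebraMap (locModel W A) E z := by
      apply Subtype.ext
      rw [hψ, hι]
      show σ (z : L) = (z : L)
      rw [← hc, AlgEquiv.commutes]
    rw [SetLike.mem_coe, h3]
    exact Ideal.mem_map_of_mem _ ((hmS z).mpr hvz)
  have hA'T : ∀ a (ha : a ∈ A), (⟨σ a, hσSE ⟨a, le_locModel W A ha⟩⟩ : E) ∈ T := by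
    intro a ha
    obtain ⟨f, hf0, hfa⟩ := exists_aeval_valuation_lt_one W hk hres (hAW' a ha)
    refine hT_of _ f hf0 ?_
    obtain ⟨n, hn⟩ := hprim (aeval (⟨a, le_locModel W A ha⟩ : locModel W A) f)
      (by rw [aeval_subalgebra_coe]; exact hfa)
    have h1 : aeval (⟨σ a, hσSE ⟨a, le_locModel W A ha⟩⟩ : E) f =
        ψ (aeval (⟨a, le_locModel W A ha⟩ : locModel W A) f) := by
      rw [← aeval_algHom_apply]
      rfl
    rw [h1]
    refine Ideal.mem_radical_iff.mpr ⟨n, ?_⟩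
    rw [← map_pow]
    exact hψI (Ideal.mem_map_of_mem _ hn)
  -- `B ⊆ T`
  have hBT : ∀ b (hb : b ∈ B), (⟨b, le_locModel W B hb⟩ : E) ∈ T := by
    have hle : B ≤ T.map E.val := by
      refine sup_le (fun a ha => ?_) (fun x hx => ?_)
      · exact Subalgebra.mem_map.mpr ⟨_, hAT a ha, rfl⟩
      · obtain ⟨a, ha, rfl⟩ := Subalgebra.mem_map.mp hx
        exact Subalgebra.mem_map.mpr ⟨_, hA'T a ha, rfl⟩
    intro b hb
    obtain ⟨y, hyT, hyb⟩ := Subalgebra.mem_map.mp (hle hb)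
    have hy : y = ⟨b, le_locModel W B hb⟩ := Subtype.ext hyb
    rwa [hy] at hyT
  -- `m_E ⊆ J`, whence `m_S E` has `m_E` as its only prime
  have hmEJ : maximalIdeal E ≤ J := by
    intro x hx
    have hvx := (hmE x).mp hx
    obtain ⟨b, hb, t, ht, hvt, hxe⟩ := (mem_locModel_iff W B).mp x.2
    have hvb : W.valuation b < 1 := by rwa [hxe, valuation_mul_inv_eq W hvt] at hvx
    have hbJ : (⟨b, le_locModel W B hb⟩ : E) ∈ J := hJ_of_T _ (hBT b hb) hvb
    have hxbt : x = ⟨b, le_locModel W B hb⟩ *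
        ⟨t⁻¹, inv_mem_locModel W B (le_locModel W B ht) hvt⟩ := Subtype.ext hxe
    rw [hxbt]
    exact J.mul_mem_right _ hbJ
  have hrad : ∀ P : Ideal E, P.IsPrime → I ≤ P → P = maximalIdeal E := fun P hP hIP =>
    ((IsLocalRing.maximalIdeal.isMaximal E).eq_of_le hP.ne_top
      (hmEJ.trans ((hP.radical_le_iff).mpr hIP))).symm
  -- `κ(E)/κ(S)` is algebraic
  have halg : ∀ x : E, ∃ p : (locModel W A)[X], (∃ i, p.coeff i ∉ maximalIdeal (locModel W A)) ∧
      eval₂ (algebraMap (locModel W A) E) x p ∈ maximalIdeal E := by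
    intro x
    obtain ⟨f, hf0, hfx⟩ := exists_aeval_valuation_lt_one W hk hres (hEW _ x.2)
    refine ⟨f.map (algebraMap k (locModel W A)), ⟨f.natDegree, ?_⟩, ?_⟩
    · rw [coeff_map]
      have hu : IsUnit (algebraMap k (locModel W A) (f.coeff f.natDegree)) :=
        ((leadingCoeff_ne_zero.mpr hf0).isUnit).map _
      exact fun h => (mem_nonunits_iff.mp ((IsLocalRing.mem_maximalIdeal _).mp h)) hu
    · rw [eval₂_map, ← IsScalarTower.algebraMap_eq k (locModel W A) E, ← aeval_def, hmE,
        aeval_subalgebra_coe]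
      exact hfx
  -- Zariski's Main Theorem: `S = E`
  have hbij := bijective_algebraMap_of_essFiniteType_of_forall_isPrime
    (N := locModel W A) (S := E) (K := L) (fun _ _ h => Subtype.ext h) hrad halg
  rintro _ ⟨s, hs, rfl⟩
  obtain ⟨s', hs'⟩ := hbij.2 ⟨σ s, hσSE ⟨s, hs⟩⟩
  have h : (s' : L) = σ s := congrArg Subtype.val hs'
  rw [← h]
  exact s'.2

/-- **Conjugate stability from primary contraction, PROVED** (`ConjugateStability` of
`StableModelCriterion2008.lean`; [Fu1997] p. 614 after [Abhyankar1957, Prop. 1]; the sentence of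
HAL p. 30, l. 14–16 in the case it is used): for `σ ∈ Aut(L/K)` with `σW = W`, `κ(W)/k`
algebraic, `S` a local uniformization of `W/k` with `(m_S ∩ K)S` primary for `m_S`, `σS = S`
(`image_subset_of_smul_eq` for `σ` and for `σ⁻¹`).
[cite: Fu1997, Introduction (p. 614); CossartPiltant2008, Lemma 9.4 proof (HAL p. 30, l. 14-16)] -/
theorem conjugateStability_holds : ConjugateStability.{u} := by
  intro k K _ _ _ L _ _ _ _ W hk hres σ hσ S hS hprim
  refine Set.Subset.antisymm (image_subset_of_smul_eq W hk hres σ hσ hS hprim) fun s hs => ?_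
  have h := image_subset_of_smul_eq W hk hres σ⁻¹ (inv_smul_eq_iff.mpr hσ.symm) hS hprim
    ⟨s, hs, rfl⟩
  refine ⟨σ⁻¹ s, h, ?_⟩
  rw [AlgEquiv.aut_inv, AlgEquiv.apply_symm_apply]

end Main

/-! ### (S3\*) and Lemma 9.4 for `k = k̄`, rational rank `≥ 2`, without the criterion binder -/

/-- **(S3\*) from Fu's primary contraction** (`gStableUniformizationAbove_of_primary` with the
criterion discharged by `conjugateStability_holds`): for `W` fixed by every element of
`Gal(L/K)`, `k` algebraically closed, `κ(W)/k` algebraic, rational rank `≥ 2` and `W` locally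
uniformizable, every normal local model `R₀` of `V = W ∩ K` admits a `Gal(L/K)`-stable local
uniformization of `W` above `R̃₀`. Leaves: Cor 4.6 (`Cofinality`), `R̃₀` a local model
(`NormalModelAboveLe`, proved in `NormalModelAbove2008`), [Fu1997, Thm 3.6] (`FuPrimaryTransform`).
[cite: CossartPiltant2008, Lemma 9.4 proof (HAL p. 30, l. 14-16); Fu1997, Thm 3.6] -/
theorem gStableUniformizationAbove_of_fu (hcof : Cofinality.{u})
    (hnm : NormalModelAboveLe.{u}) (hFu : FuPrimaryTransform.{u})
    {k K : Type u} [Field k] [Field K] [Algebra k K] (hac : IsAlgClosed k)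
    (hfg : (⊤ : IntermediateField k K).FG) (htr : Algebra.trdeg k K = 3)
    {L : Type u} [Field L] [Algebra K L] [Algebra k L] [IsScalarTower k K L]
    [FiniteDimensional K L] (W : ValuationSubring L) (hk : ∀ c : k, algebraMap k L c ∈ W)
    (hres : residueTrdeg k W hk = 0) (hrr : (2 : Cardinal) ≤ ratRank W)
    (hfix : ∀ σ : L ≃ₐ[K] L, σ • W = W) (hLU : IsLocallyUniformizable k L W)
    (R₀ : Subalgebra k K) (hR₀ : IsNormalLocalModelOf k K (W.comap (algebraMap K L)) R₀) :
    GStableUniformizationAbove (K := K) W R₀ :=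
  gStableUniformizationAbove_of_primary hcof hnm hFu conjugateStability_holds hac hfg htr W hk
    hres hrr hfix hLU R₀ hR₀

/-- **Lemma 9.4 for `k = k̄` and rational rank `≥ 2` from printed statements**
(`tamePrimeDescentHighRank_of_leaves` with the criterion discharged by
`conjugateStability_holds`): Prop 9.3 (`DescentBelowInertiaField`), the printed argument of
HAL p. 30 l. 16–65 (`TamePrimeDescentViaStableModel`), Cor 4.6 (`Cofinality`), `R̃₀` a local
model (`NormalModelAboveLe`, proved in `NormalModelAbove2008`) and [Fu1997, Thm 3.6]
(`FuPrimaryTransform`) give `TamePrimeDescentHighRank`.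
[cite: CossartPiltant2008, Lemma 9.4 (HAL p. 29-30); Fu1997, Thm 3.6] -/
theorem tamePrimeDescentHighRank_of_printed (h93 : DescentBelowInertiaField.{u})
    (h₁ : TamePrimeDescentViaStableModel.{u}) (hcof : Cofinality.{u})
    (hnm : NormalModelAboveLe.{u}) (hFu : FuPrimaryTransform.{u}) :
    TamePrimeDescentHighRank.{u} :=
  tamePrimeDescentHighRank_of_leaves h93 h₁ hcof hnm hFu conjugateStability_holds

end Literature.AlgebraicGeometry.CossartPiltant200819.CP2008

end
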